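import Summits.FinalStateConjecture.FinalStateConjecture.Theorems.DerivativeThriftThriftyClusterSettlingOuterFlatnessForced
import Summits.FinalStateConjecture.FinalStateConjecture.Theorems.DerivativeThriftThriftyHandoffMinkowskiHandoff
import Summits.FinalStateConjecture.FinalStateConjecture.Theorems.PhotonSphereChannelsChannelsResolveTameDevelopmentsRMinkowskiMaximal
import Summits.FinalStateConjecture.FinalStateConjecture.Theorems.ZeroEnergyKerrOrBombStationaryLimitReductionOneDevelopment
import HarnessLib

/-!
# Crux `ThriftyClusterSettling` (stmt-FinalStateConjecture-17611, route DerivativeThrift) HOLDS ON THE WHOLE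
# FIBRE OVER THE TRIVIAL DATUM, and its hypothesis block is inhabited together with its conclusion at one
# certified development (anti-vacuity certificate of line `registered`, lead c4)

Four line leads found the crux as filed MISSTATED on non-flat fibres (its consequent forces late sup-`C²`
flatness of the cone complement, `thriftyClusterSettling_forces_outerFlatness`, fed by no hypothesis).  This
file records the complementary kernel facts on the one fibre the tree can certify, `X = ℝ³ = Minkowski.slice`,
`D = trivialData = (ℝ³, δ, 0)`:

* `settles_of_isMaximal_trivialData` — EVERY maximal vacuum Cauchy development `𝒟` of the trivial datum carries
  an honest sub-extremal `C²` final-state decomposition of its self-determined exterior with exhaustive,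
  future-oriented charts (the crux's consequent), UNCONDITIONALLY: `𝒟` is isometric, as a development, to
  Minkowski space (`Minkowski.isIsometricTo_vacuumCauchyDevelopment_of_isMaximal`: Minkowski space is
  geodesically complete, so its embedding into `𝒟` is onto — Choquet-Bruhat–Geroch 1969, Thm. 3; Ringström
  2009, Thm. 16.6), the honest `N = 0` decomposition of Minkowski space
  (`ChannelsResolveTameDevelopmentsR.TrivialDatum.settlesT2_minkowski`) is pushed forward
  (`OneLockedExplosion.transportDecomposition`, `ψ(O) = exteriorOf 𝒟 ψ(charted)` by `image_exteriorOf`),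
  exhaustiveness rides along (`hasExhaustiveCharts_transportDecomposition`) and future orientation of the
  charts by the chain rule and O'Neill's timecone lemma (`PreservesTimeOrientation.isFutureDirected_mfderiv`).
  (The tree's packaged copies of this transport — `…RTrivialDatumMGHD.settlesT2_of_isMaximal` and the refuter's
  `DrainImpliesDisperse.Negative.exists_dispersiveDecomposition_of_isMaximal` — live in modules without oleans on
  the farm on 2026-08-17, so the transport is re-assembled here from built constituents, the orientation step
  inlined; the ray clause is not needed by this crux.)
* `thriftyClusterSettling_trivialData` — the BODY of the crux at `X = ℝ³`, `D = trivialData`, binder for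
  binder (`ThriftyKerrStability`, admissibility, complete `𝓘⁺` and the thrifty hand-over are idle).
* `outerFlatness_of_isMaximal_trivialData`, `stub_outerZoneFlatness_trivialData` — the line's unfed stub
  `stub_outerZoneFlatness` HOLDS on this fibre (consequent ⇒ outer flatness, `outerFlatness_of_settles`).
* `cruxHypotheses_and_consequent_minkowski` — given the Choquet-Bruhat–Geroch existence theorem (for
  maximality of Minkowski space), ALL hypotheses of the crux (admissible datum, MGHD, complete `𝓘⁺`, thrifty
  hand-over — `fullHandoff_minkowski`, exact `0`-hole layers with `𝔑 = 0`) hold TOGETHER WITH its conclusion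
  and with outer flatness at `Minkowski.vacuumCauchyDevelopment`.

So the `TKS → ∀ 𝒟, IsMaximal → complete 𝓘⁺ → hand-over → settles` shape of the crux is neither vacuous nor
refutable over flat data: a counterexample needs a constructed NON-FLAT admissible MGHD (none in the tree; on
paper, far-field focusing packets — line dossiers `Cruxes/ThriftyClusterSettling/Lines/registered-dead*.md`).
No `sorry`; built tree modules only.  References: Choquet-Bruhat–Geroch, CMP 14 (1969), Thm. 3; Ringström,
*The Cauchy problem in General Relativity* (2009), Thm. 16.6; O'Neill 1983, Ch. 5, p. 145;
Christodoulou–Klainerman 1993, Thm. 1.0.2; Dafermos–Luk arXiv:1710.01722, Conjecture 1; DHRT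
arXiv:2104.08222, §1.  Lead prover-line-stmt-FinalStateConjecture-17611-c4-0 and its stub-worker, 2026-08-17.
-/

noncomputable section

-- D-0017: single-problem summit, `Summit.<S>.<S>.…` by design
set_option linter.dupNamespace false

open scoped Manifold ContDiff Topology ENNReal
open Filter Set Literature.Geometry.Lorentzian

namespace Summit.FinalStateConjecture.FinalStateConjecture.Theorems.DerivativeThrift.ThriftyClusterSettling.TrivialFibre

open Summit.FinalStateConjecture.FinalStateConjecture.Theorems.OneLockedExplosion
  (transportDecomposition charted_transportDecomposition mdifferentiable_diffeomorph image_exteriorOf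
    hasExhaustiveCharts_transportDecomposition)
open Summit.FinalStateConjecture.FinalStateConjecture.Theorems.DerivativeThriftThriftyHandoff (FullHandoff
  fullHandoff_minkowski)

/-! ### Every MGHD of the trivial datum settles in the crux's sense -/

/-- **EVERY maximal vacuum Cauchy development of the trivial datum `(ℝ³, δ, 0)` settles in the re-typed sense of
the crux**, unconditionally: a region `O` and a `C²` final-state decomposition `d` with sub-extremal holes
(`N = 0`), `O = exteriorOf 𝒟 d.charted`, `HasExhaustiveCharts d`, `IsFutureOriented d`.  MGHD uniqueness
(`Minkowski.isIsometricTo_vacuumCauchyDevelopment_of_isMaximal`) + the honest decomposition of Minkowski space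
(`settlesT2_minkowski`) transported along the isometry.  [cite: Ringstrom2009, Thm. 16.6] -/
theorem settles_of_isMaximal_trivialData (𝒟 : VacuumCauchyDevelopment trivialData) (hmax : 𝒟.IsMaximal) :
    ∃ (O : Set 𝒟.carrier) (d : FinalStateDecomposition 𝒟.toSpacetime O 2),
      (∀ i, Kerr.IsSubextremal (d.mass i) (d.spin i)) ∧ O = exteriorOf 𝒟.toCauchyDevelopment d.charted ∧
        HasExhaustiveCharts d ∧ IsFutureOriented d := by
  -- MGHD uniqueness: `𝒟` is isometric, as a development, to Minkowski space
  obtain ⟨ψ, hiso, hτ, hι⟩ := Minkowski.isIsometricTo_vacuumCauchyDevelopment_of_isMaximal hmax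
  -- the honest `N = 0` decomposition of Minkowski space
  obtain ⟨-, O, d, hsub, hO, -, hex, hfo⟩ := ChannelsResolveTameDevelopmentsR.TrivialDatum.settlesT2_minkowski
  -- future-directed push-forwards ride along `ψ ∘ Ψ` (chain rule + O'Neill's timecone lemma)
  have step : ∀ {U : TopologicalSpace.Opens E4} {Ψ : U → Minkowski.vacuumCauchyDevelopment.carrier},
      ContMDiff 𝓘(ℝ, E4) (𝓡 4) ∞ Ψ → ∀ {x : U} {v : E4},
        Minkowski.vacuumCauchyDevelopment.timeOrientation.IsFutureDirected (mfderiv 𝓘(ℝ, E4) (𝓡 4) Ψ x v) →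
          𝒟.timeOrientation.IsFutureDirected (mfderiv 𝓘(ℝ, E4) (𝓡 4) (ψ ∘ Ψ) x v) := by
    intro U Ψ hΨ x v hv
    have hc : MDifferentiableAt 𝓘(ℝ, E4) (𝓡 4) Ψ x := (hΨ.mdifferentiable (by simp)) x
    rw [mfderiv_comp x (mdifferentiable_diffeomorph ψ _) hc]
    exact hτ.isFutureDirected_mfderiv hiso hv
  have hfo' : IsFutureOriented (transportDecomposition (𝓢₁ := Minkowski.vacuumCauchyDevelopment.toSpacetime)
      (𝓢₂ := 𝒟.toSpacetime) ψ hiso hτ d) := by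
    obtain ⟨h₁, h₂, h₃⟩ := hfo
    exact ⟨h₁, fun i ρ ↦ (h₂ i ρ).mono fun τ hτ' x hx ↦ step (d.isLateChart i).contMDiff (hτ' x hx),
      h₃.mono fun τ hτ' x hx ↦ step d.isLateChart_flat.contMDiff (hτ' x hx)⟩
  refine ⟨ψ '' O, transportDecomposition (𝓢₁ := Minkowski.vacuumCauchyDevelopment.toSpacetime)
      (𝓢₂ := 𝒟.toSpacetime) ψ hiso hτ d, hsub, ?_,
    hasExhaustiveCharts_transportDecomposition _ hiso hτ d hex, hfo'⟩
  rw [charted_transportDecomposition, ← image_exteriorOf ψ hiso hτ hι, ← hO]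

/-- **THE BODY OF THE CRUX `ThriftyClusterSettling` AT `X = ℝ³`, `D = trivialData` HOLDS**, binder for binder
(unconditionally; `ThriftyKerrStability`, admissibility, complete `𝓘⁺` and the thrifty hand-over
`FullHandoff 𝒟` — verbatim the crux's antecedent — are idle: maximality alone drives the proof through MGHD
uniqueness).  So a refutation of the crux as filed needs a NON-FLAT admissible datum.
[cite: DafermosLuk2017, Conjecture 1] -/
theorem thriftyClusterSettling_trivialData : Theses.DerivativeThrift.ThriftyKerrStability →
    trivialData ∈ admissibleVacuumData Minkowski.slice →
    ∀ 𝒟 : VacuumCauchyDevelopment trivialData, 𝒟.IsMaximal →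
      HasCompleteNullInfinity 𝒟.toCauchyDevelopment → FullHandoff 𝒟 →
      ∃ (O : Set 𝒟.carrier) (d : FinalStateDecomposition 𝒟.toSpacetime O 2),
        (∀ i, Kerr.IsSubextremal (d.mass i) (d.spin i)) ∧ O = exteriorOf 𝒟.toCauchyDevelopment d.charted ∧
          HasExhaustiveCharts d ∧ IsFutureOriented d :=
  fun _ _ 𝒟 hmax _ _ ↦ settles_of_isMaximal_trivialData 𝒟 hmax

/-! ### The unfed stub `stub_outerZoneFlatness` holds on this fibre -/

/-- **Every MGHD of the trivial datum is outer-flat** (the body of the skeleton's `OuterFlatness 𝒟`: aperture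
`θ > 0`, a late flat chart on an open `V ⊇ {x⁰ > τₑ, |x̲| > (1 − θ) x⁰}` into `J⁺(ι ℝ³)` with full-slab `C²`
deviation `→ 0` and `∂₀` eventually future-directed): the consequent of the crux forces outer flatness
(`outerFlatness_of_settles`, lead c3) and holds here (`settles_of_isMaximal_trivialData`).
[cite: arXiv210408222, §1] -/
theorem outerFlatness_of_isMaximal_trivialData (𝒟 : VacuumCauchyDevelopment trivialData)
    (hmax : 𝒟.IsMaximal) :
    ∃ (θ τₑ : ℝ) (V : TopologicalSpace.Opens E4) (Φₑ : V → 𝒟.carrier), 0 < θ ∧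
      {x : E4 | τₑ < x 0 ∧ (1 - θ) * x 0 < E4.spatialNorm x} ⊆ (V : Set E4) ∧
      𝒟.toSpacetime.IsLateChart (Minkowski.backgroundOn V)
        (𝒟.metric.causalFuture 𝒟.timeOrientation (Set.range 𝒟.embed)) τₑ Φₑ ∧
      Tendsto (fun τ ↦ 𝒟.toSpacetime.deviationCk (Minkowski.backgroundOn V) Φₑ 2 τ) atTop (𝓝 0) ∧
      ∀ᶠ τ in atTop, ∀ x ∈ (Minkowski.backgroundOn V).timeSlab τ,
        𝒟.timeOrientation.IsFutureDirected (mfderiv 𝓘(ℝ, E4) (𝓡 4) Φₑ x (E4.basisVector 0)) :=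
  outerFlatness_of_settles 𝒟 (settles_of_isMaximal_trivialData 𝒟 hmax)

/-- **The registered stub `stub_outerZoneFlatness` at `X = Minkowski.slice`, `D = trivialData`** — its
signature with the leading binders instantiated at the trivial datum, token for token otherwise
(admissibility and complete `𝓘⁺` are idle).  A NON-VACUITY CERTIFICATE for the stub, not the stub.
[cite: ChoquetBruhatGeroch1969CMP, Thm. 3] -/
theorem stub_outerZoneFlatness_trivialData :
    trivialData ∈ admissibleVacuumData Minkowski.slice →
    ∀ 𝒟 : VacuumCauchyDevelopment trivialData, 𝒟.IsMaximal →
      HasCompleteNullInfinity 𝒟.toCauchyDevelopment →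
      ∃ (θ τₑ : ℝ) (V : TopologicalSpace.Opens E4) (Φₑ : V → 𝒟.carrier), 0 < θ ∧
        {x : E4 | τₑ < x 0 ∧ (1 - θ) * x 0 < E4.spatialNorm x} ⊆ (V : Set E4) ∧
        𝒟.toSpacetime.IsLateChart (Minkowski.backgroundOn V)
          (𝒟.metric.causalFuture 𝒟.timeOrientation (Set.range 𝒟.embed)) τₑ Φₑ ∧
        Tendsto (fun τ ↦ 𝒟.toSpacetime.deviationCk (Minkowski.backgroundOn V) Φₑ 2 τ) atTop (𝓝 0) ∧
        ∀ᶠ τ in atTop, ∀ x ∈ (Minkowski.backgroundOn V).timeSlab τ,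
          𝒟.timeOrientation.IsFutureDirected (mfderiv 𝓘(ℝ, E4) (𝓡 4) Φₑ x (E4.basisVector 0)) :=
  fun _ 𝒟 hmax _ ↦ outerFlatness_of_isMaximal_trivialData 𝒟 hmax

/-! ### All hypotheses of the crux hold, with its conclusion, at one certified development -/

/-- **Every hypothesis of the crux AND its conclusion (and outer flatness) hold simultaneously at ONE certified
maximal development of an admissible datum** (given the Choquet-Bruhat–Geroch existence theorem
`choquetBruhat_geroch_exists_mghd_cauchy`, a named fact of the tree, for maximality of Minkowski space): the
trivial datum is admissible, Minkowski space is its MGHD, `𝓘⁺` is complete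
(`ChannelsResolveTameDevelopmentsR.TrivialDatum.cruxHypotheses_minkowski`), it admits a thrifty hand-over with
EXACT `0`-hole layers, `𝔑 = 0` (`DerivativeThriftThriftyHandoff.fullHandoff_minkowski`), it settles in the
crux's sense and it is outer-flat.  The crux's hypothesis block is thus kernel-checked consistent and consistent
with its conclusion.  [cite: ChristodoulouKlainerman1993, Thm. 1.0.2] -/
theorem cruxHypotheses_and_consequent_minkowski (hcbg : choquetBruhat_geroch_exists_mghd_cauchy) :
    trivialData ∈ admissibleVacuumData Minkowski.slice ∧ Minkowski.vacuumCauchyDevelopment.IsMaximal ∧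
      HasCompleteNullInfinity Minkowski.vacuumCauchyDevelopment.toCauchyDevelopment ∧
      FullHandoff Minkowski.vacuumCauchyDevelopment ∧
      (∃ (O : Set Minkowski.vacuumCauchyDevelopment.carrier)
          (d : FinalStateDecomposition Minkowski.vacuumCauchyDevelopment.toSpacetime O 2),
        (∀ i, Kerr.IsSubextremal (d.mass i) (d.spin i)) ∧
          O = exteriorOf Minkowski.vacuumCauchyDevelopment.toCauchyDevelopment d.charted ∧
          HasExhaustiveCharts d ∧ IsFutureOriented d) ∧
      ∃ (θ τₑ : ℝ) (V : TopologicalSpace.Opens E4) (Φₑ : V → Minkowski.vacuumCauchyDevelopment.carrier),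
        0 < θ ∧ {x : E4 | τₑ < x 0 ∧ (1 - θ) * x 0 < E4.spatialNorm x} ⊆ (V : Set E4) ∧
        Minkowski.vacuumCauchyDevelopment.toSpacetime.IsLateChart (Minkowski.backgroundOn V)
          (Minkowski.vacuumCauchyDevelopment.metric.causalFuture
            Minkowski.vacuumCauchyDevelopment.timeOrientation
            (Set.range Minkowski.vacuumCauchyDevelopment.embed)) τₑ Φₑ ∧
        Tendsto (fun τ ↦ Minkowski.vacuumCauchyDevelopment.toSpacetime.deviationCk
          (Minkowski.backgroundOn V) Φₑ 2 τ) atTop (𝓝 0) ∧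
        ∀ᶠ τ in atTop, ∀ x ∈ (Minkowski.backgroundOn V).timeSlab τ,
          Minkowski.vacuumCauchyDevelopment.timeOrientation.IsFutureDirected
            (mfderiv 𝓘(ℝ, E4) (𝓡 4) Φₑ x (E4.basisVector 0)) := by
  obtain ⟨hD, hmax, hscri, -, -, -⟩ :=
    ChannelsResolveTameDevelopmentsR.TrivialDatum.cruxHypotheses_minkowski hcbg
  exact ⟨hD, hmax, hscri, fullHandoff_minkowski, settles_of_isMaximal_trivialData _ hmax,
    outerFlatness_of_isMaximal_trivialData _ hmax⟩

end Summit.FinalStateConjecture.FinalStateConjecture.Theorems.DerivativeThrift.ThriftyClusterSettling.TrivialFibre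

end
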